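import Mathlib
import HarnessLib
import Literature.Analysis.FluidPDE.VectorCalculus
import Summits.NavierStokesRegularity.NavierStokesRegularity.Theorems.UnthreadedRigidityDoorUnthreadedRigidityCoZonalAngular
import Summits.NavierStokesRegularity.NavierStokesRegularity.Theorems.UnthreadedRigidityDoorUnthreadedRigidityCoZonalAxes
import Summits.NavierStokesRegularity.NavierStokesRegularity.Theorems.UnthreadedRigidityDoorUnthreadedRigidityCoZonalOrderOne
import Summits.NavierStokesRegularity.NavierStokesRegularity.Theorems.UnthreadedRigidityDoorUnthreadedRigidityCoZonalCompositions

/-!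
# W2 door `UnthreadedRigidity` — LINE g12-1 «CO-ZONAL»: support CZ-a `CommutingAngularSilence`, III — by name

engine-1 g71 (KEY-NS #205 (d)).  ★ `commutingAngularSilence_holds : CommutingAngularSilence`: two solid harmonics of different
degrees `≥ 1` that Poisson-commute, the second one nonzero, have `𝒜(Y₁) = {Y₁,|∇Y₁|²} ≡ 0`.  The wrapper of the engine
`angForm_eq_zero_of_transfer` (`…CoZonalAngular`): on `U = {R₂ = y × ∇Y₂ ≠ 0}` the transfer law `∇Y₁ = λ∇Y₂ + μy` holds with
the explicit smooth `λ = ⟪R₁,R₂⟫/|R₂|²`, `μ = (l₁Y₁ − λl₂Y₂)/|y|²` (`{Y₁,Y₂} = 0` makes `R₁ ∥ R₂`, then `y × (∇Y₁ − λ∇Y₂) = 0`);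
the engine gives `𝒜(Y₁) = 0` on `U`, and `U` meets every nonempty open set by LEMMA R (`exists_rot_ne_zero_of_isOpen`,
`…CoZonalAxes`), so `𝒜(Y₁) ≡ 0` by continuity.

CONSEQUENCES BY NAME (§3, compositions of `…CoZonalCompositions` with every support now a tree theorem): the dichotomy form of O1₂
`twoShellSliceOrderOneLaw_holds`, ★★ the CO-ZONAL LEMMA `coZonalLemma_holds : CoZonalLemma` (S-C `angularLemma_holds` + CZ-a + CZ-b),
★★ the SLICE DICHOTOMY at all degree pairs `twoShellSliceDichotomyAll_holds : TwoShellSliceDichotomyAll` (order-one silence of a two-shell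
over nonzero solid harmonics of different degrees ⇒ axisymmetric about `x₀` OR linked profiles — a statement about data, no window), and the
window rung modulo O1-W and the residual R (`twoShellWindowRigidityAll_of_residual`).

LABEL: support lemma of a MODEL line (W2 door, item 27585 OPEN); not a statement about the Navier–Stokes equations.  0 kit.
-/

-- the summit and its single sub-problem share the name (CONVENTIONS §1), as in every Theorems file
set_option linter.dupNamespace false

namespace Summit.NavierStokesRegularity.NavierStokesRegularity.Theorems.UnthreadedRigidity.CoZonal

open scoped Topology InnerProductSpace
open Filter Set
open Literature.Analysis.FluidPDE (cross)
open Summit.NavierStokesRegularity.NavierStokesRegularity.Theorems.UnthreadedRigidity.VirialHorn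
open Summit.NavierStokesRegularity.NavierStokesRegularity.Theorems.UnthreadedRigidity.ProfileHorn (E3)
open Summit.NavierStokesRegularity.NavierStokesRegularity.Theorems.UnthreadedRigidity.ThreadingJets (contDiff_cross_gradient
  contDiff_angForm)

/-! ## Coordinates (private copies) -/

/-- components of the cross product. -/
private theorem cross_apply_zero (u v : E3) : cross u v 0 = u 1 * v 2 - u 2 * v 1 := by simp [cross, cross_apply]
/-- components of the cross product. -/
private theorem cross_apply_one (u v : E3) : cross u v 1 = u 2 * v 0 - u 0 * v 2 := by simp [cross, cross_apply]
/-- components of the cross product. -/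
private theorem cross_apply_two (u v : E3) : cross u v 2 = u 0 * v 1 - u 1 * v 0 := by simp [cross, cross_apply]
/-- the inner product in coordinates. -/
private theorem real_inner_e3 (u v : E3) : ⟪u, v⟫_ℝ = u 0 * v 0 + u 1 * v 1 + u 2 * v 2 := by
  simp [PiLp.inner_apply, Fin.sum_univ_three, mul_comm]

/-- `(y × a) × (y × b) = det[y,a,b] y`. -/
private theorem cross_rot_rot (y a b : E3) : cross (cross y a) (cross y b) = det3 y a b • y := by
  ext i
  fin_cases i <;> simp [cross_apply_zero, cross_apply_one, cross_apply_two, det3] <;> ring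

/-- `y × (a − c • b) = y × a − c • (y × b)`. -/
private theorem cross_sub_smul_right (y a b : E3) (c : ℝ) : cross y (a - c • b) = cross y a - c • cross y b := by
  ext i
  fin_cases i <;> simp [cross_apply_zero, cross_apply_one, cross_apply_two] <;> ring

/-- `u × (v × w) = ⟪u,w⟫ v − ⟪u,v⟫ w`. -/
private theorem cross_cross_eq (u v w : E3) : cross u (cross v w) = ⟪u, w⟫_ℝ • v - ⟪u, v⟫_ℝ • w := by
  ext i
  fin_cases i <;> simp [cross_apply_zero, cross_apply_one, cross_apply_two, real_inner_e3] <;> ring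

/-- parallel vectors from a vanishing cross product: `X × Z = 0 ⇒ ‖Z‖² X = ⟪Z, X⟫ Z`. -/
private theorem smul_eq_of_cross_eq_zero {X Z : E3} (h : cross X Z = 0) : ⟪Z, Z⟫_ℝ • X = ⟪Z, X⟫_ℝ • Z := by
  have := cross_cross_eq Z X Z
  rw [h] at this
  have h0 : cross Z (0 : E3) = 0 := by
    ext i; fin_cases i <;> simp [cross_apply_zero, cross_apply_one, cross_apply_two]
  rw [h0] at this
  exact (sub_eq_zero.mp this.symm)

/-- the same about the first slot: `y × v = 0 ⇒ ‖y‖² v = ⟪y, v⟫ y`. -/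
private theorem smul_eq_of_cross_self_eq_zero {y v : E3} (h : cross y v = 0) : ⟪y, y⟫_ℝ • v = ⟪y, v⟫_ℝ • y := by
  have h' : cross v y = 0 := by
    have hneg : cross v y = -cross y v := by
      ext i; fin_cases i <;> simp [cross_apply_zero, cross_apply_one, cross_apply_two] <;> ring
    rw [hneg, h, neg_zero]
  exact smul_eq_of_cross_eq_zero h'

/-! ## CZ-a by name -/

/-- ★ SUPPORT CZ-a «COMMUTING ⇒ ANGULAR SILENCE» (`CommutingAngularSilence`, LINE g12-1 CO-ZONAL, ns-idea-6 `CoZonal_sketch`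
c7eabdeb25f1685c): `{Y₁,Y₂} ≡ 0` with `l₁ ≠ l₂`, `Y₂ ≢ 0` forces `𝒜(Y₁) ≡ 0`.  (Transfer law on `U = {y × ∇Y₂ ≠ 0}` with explicit
smooth `λ, μ`; the engine `angForm_eq_zero_of_transfer`; density of `U` by LEMMA R; continuity of `𝒜(Y₁)`.) -/
theorem commutingAngularSilence_holds : CommutingAngularSilence := by
  intro l₁ l₂ Y₁ Y₂ _hl₁ hl₂ hl hY₁ hY₂ hne₂ hP y
  -- the open set `U` and the transfer functions
  have hUo : IsOpen {z : E3 | cross z (gradient Y₂ z) ≠ 0} := isOpen_ne_fun (continuous_rot hY₂) continuous_const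
  obtain ⟨lam, hlam⟩ : ∃ f : E3 → ℝ, f = fun z : E3 =>
      ⟪cross z (gradient Y₁ z), cross z (gradient Y₂ z)⟫_ℝ / ⟪cross z (gradient Y₂ z), cross z (gradient Y₂ z)⟫_ℝ :=
    ⟨_, rfl⟩
  obtain ⟨mu, hmu⟩ : ∃ f : E3 → ℝ, f = fun z : E3 =>
      (((l₁ : ℝ) * Y₁ z - lam z * ((l₂ : ℝ) * Y₂ z))) / ⟪z, z⟫_ℝ := ⟨_, rfl⟩
  -- the transfer law on `U`
  have hF : ∀ z ∈ {z : E3 | cross z (gradient Y₂ z) ≠ 0}, gradient Y₁ z = lam z • gradient Y₂ z + mu z • z := by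
    intro z hz
    have hzR : cross z (gradient Y₂ z) ≠ 0 := hz
    have hz0 : z ≠ 0 := ne_zero_of_rot_ne_zero hzR
    have hA : ⟪cross z (gradient Y₂ z), cross z (gradient Y₂ z)⟫_ℝ ≠ 0 := (real_inner_self_pos.2 hzR).ne'
    have hQ : ⟪z, z⟫_ℝ ≠ 0 := (real_inner_self_pos.2 hz0).ne'
    -- `R₁ = λ R₂`
    have hRR : cross (cross z (gradient Y₁ z)) (cross z (gradient Y₂ z)) = 0 := by
      rw [cross_rot_rot]
      have h0 : det3 z (gradient Y₁ z) (gradient Y₂ z) = 0 := hP z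
      rw [h0, zero_smul]
    have h1 := smul_eq_of_cross_eq_zero hRR
    have hR₁ : cross z (gradient Y₁ z) = lam z • cross z (gradient Y₂ z) := by
      have : cross z (gradient Y₁ z) = (⟪cross z (gradient Y₂ z), cross z (gradient Y₂ z)⟫_ℝ)⁻¹ •
          (⟪cross z (gradient Y₂ z), cross z (gradient Y₂ z)⟫_ℝ • cross z (gradient Y₁ z)) := by
        rw [smul_smul, inv_mul_cancel₀ hA, one_smul]
      rw [this, h1, smul_smul]
      congr 1
      rw [hlam]
      beta_reduce
      rw [div_eq_inv_mul, real_inner_comm (cross z (gradient Y₁ z)) (cross z (gradient Y₂ z))]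
    -- `z × (∇Y₁ − λ∇Y₂) = 0`
    have hc : cross z (gradient Y₁ z - lam z • gradient Y₂ z) = 0 := by
      rw [cross_sub_smul_right, hR₁, sub_self]
    have h2 := smul_eq_of_cross_self_eq_zero hc
    rw [inner_sub_right, real_inner_smul_right, hY₁.inner_self_gradient, hY₂.inner_self_gradient] at h2
    have h3 : gradient Y₁ z - lam z • gradient Y₂ z = mu z • z := by
      have : gradient Y₁ z - lam z • gradient Y₂ z =
          (⟪z, z⟫_ℝ)⁻¹ • (⟪z, z⟫_ℝ • (gradient Y₁ z - lam z • gradient Y₂ z)) := by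
        rw [smul_smul, inv_mul_cancel₀ hQ, one_smul]
      rw [this, h2, smul_smul]
      congr 1
      rw [hmu]
      beta_reduce
      rw [div_eq_inv_mul]
    rw [← h3, add_sub_cancel]
  -- smoothness of `λ` and `μ` on `U`
  have hrot₁ := contDiff_cross_gradient hY₁
  have hrot₂ := contDiff_cross_gradient hY₂
  have hnum : ContDiff ℝ 2 (fun z : E3 => ⟪cross z (gradient Y₁ z), cross z (gradient Y₂ z)⟫_ℝ) :=
    (hrot₁.inner ℝ hrot₂).of_le (by norm_cast)
  have hden : ContDiff ℝ 2 (fun z : E3 => ⟪cross z (gradient Y₂ z), cross z (gradient Y₂ z)⟫_ℝ) :=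
    (hrot₂.inner ℝ hrot₂).of_le (by norm_cast)
  have hlamC : ∀ z ∈ {z : E3 | cross z (gradient Y₂ z) ≠ 0}, ContDiffAt ℝ 2 lam z := by
    intro z hz
    rw [hlam]
    exact hnum.contDiffAt.div hden.contDiffAt (real_inner_self_pos.2 hz).ne'
  have hY₁2 : ContDiff ℝ 2 Y₁ := hY₁.contDiff.of_le (by norm_cast)
  have hY₂2 : ContDiff ℝ 2 Y₂ := hY₂.contDiff.of_le (by norm_cast)
  have hzz : ContDiff ℝ 2 (fun z : E3 => ⟪z, z⟫_ℝ) := contDiff_id.inner ℝ contDiff_id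
  have hmuC : ∀ z ∈ {z : E3 | cross z (gradient Y₂ z) ≠ 0}, DifferentiableAt ℝ mu z := by
    intro z hz
    have hz0 : z ≠ 0 := ne_zero_of_rot_ne_zero hz
    rw [hmu]
    exact (((contDiffAt_const.mul hY₁2.contDiffAt).sub ((hlamC z hz).mul (contDiffAt_const.mul hY₂2.contDiffAt))).div
      hzz.contDiffAt (real_inner_self_pos.2 hz0).ne').differentiableAt (by simp)
  -- the engine on `U`, then density of `U` and continuity of `𝒜(Y₁)`
  have hmain := angForm_eq_zero_of_transfer hY₁ hY₂ hl hUo (fun z hz => hz) hF hlamC hmuC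
  by_contra hAy
  obtain ⟨z, hzO, hzR⟩ := exists_rot_ne_zero_of_isOpen hY₂ hl₂ hne₂
    (isOpen_ne_fun (contDiff_angForm hY₁).continuous continuous_const) ⟨y, hAy⟩
  exact hzO (hmain z hzR)

/-! ## The co-zonal lemma and the slice dichotomy, unconditionally -/

/-- ★ BRIDGE O1₂ in dichotomy form, by name (`twoShellSliceOrderOneLaw_of_identity` with O1₂ `twoShellSliceOrderOneIdentity_holds` and
`pbrHomogeneous_holds`): order-one silence of a two-shell ⇒ `{Y₁,Y₂} ≡ 0 ∨ Λ ≡ 0`. -/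
theorem twoShellSliceOrderOneLaw_holds : TwoShellSliceOrderOneLaw :=
  twoShellSliceOrderOneLaw_of_identity twoShellSliceOrderOneIdentity_holds pbrHomogeneous_holds

/-- ★★ THE CO-ZONAL LEMMA CZ (`CoZonalLemma`, LINE g12-1): nonzero solid harmonics of different degrees `≥ 1` that Poisson-commute are
zonal about a common axis (`coZonalLemma_of_supports` with S-C `angularLemma_holds`, CZ-a `commutingAngularSilence_holds`, CZ-b
`zonalAxesMatch_holds`). -/
theorem coZonalLemma_holds : CoZonalLemma :=
  coZonalLemma_of_supports angularLemma_holds commutingAngularSilence_holds zonalAxesMatch_holds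

/-- ★★ THE TWO-SHELL SLICE DICHOTOMY AT ALL DEGREE PAIRS (`TwoShellSliceDichotomyAll`, LINE g12-1's non-hypothetical content): for
two-shell data over nonzero solid harmonics of different degrees `≥ 1` with virial-admissible profiles, order-one silence of the threading
flux about `x₀` forces «slice-axisymmetric about `x₀`» or «linked profiles» (`twoShellSliceDichotomyAll_of_bridges` with the three
supports above and Z⁺ `coZonalShellAxisym_holds`). -/
theorem twoShellSliceDichotomyAll_holds : TwoShellSliceDichotomyAll :=
  twoShellSliceDichotomyAll_of_bridges twoShellSliceOrderOneLaw_holds coZonalLemma_holds coZonalShellAxisym_holds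

/-- THE WINDOW RUNG modulo O1-W and the residual R: `WindowOrderOneSilence → LinkedPairWindowRigidityAll → TwoShellWindowRigidityAll`. -/
theorem twoShellWindowRigidityAll_of_residual (hW : WindowOrderOneSilence) (hR : LinkedPairWindowRigidityAll) :
    TwoShellWindowRigidityAll :=
  twoShellWindowRigidityAll_of_bridges hW twoShellSliceOrderOneLaw_holds coZonalLemma_holds coZonalShellAxisym_holds hR

end Summit.NavierStokesRegularity.NavierStokesRegularity.Theorems.UnthreadedRigidity.CoZonal
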